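import Literature.AlgebraicGeometry.Motives.MixedHodgeExtension
import HarnessLib

/-!
# Carlson's theorem, I: every class in `J⁰Hom(A, B)` is an extension class

Continuation of `Literature/AlgebraicGeometry/Motives/MixedHodgeExtension.lean`. For separated
mixed `ℚ`-Hodge structures `A` (on `VA`) and `B` (on `VB`) (`IsSeparated A B`: all weights of `B`
below all weights of `A`) and any `ψ ∈ Hom_ℂ(A_ℂ, B_ℂ)` we construct Carlson's **normalized
extension** `E_ψ` (Carlson, *Extensions of mixed Hodge structures* (1980), proof of Prop. 2):
the `ℚ`-space `VA × VB` with the direct-sum weight filtration `W_k = W_k A ⊕ W_k B` ("the only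
choice which makes `0 → A_ℚ → L_ℚ → B_ℚ → 0` an exact sequence of filtered objects") and the
twisted Hodge filtration `F^p_ψ = g(ψ)(F^p A ⊕ F^p B)`, `g(ψ) = (1 ψ; 0 1)`, i.e.
`F^p_ψ = {(x, y) ∈ A_ℂ × B_ℂ | x ∈ F^p A, y - ψ x ∈ F^p B}`. We prove that this is a mixed Hodge
structure (the twist acts trivially on every `Gr^W_k`, by separation), that
`0 → B → E_ψ → A → 0` (`inr`, `fst`) is an extension in the sense of `Extension` (strictness
included), and that its class is `[ψ]`; hence the class map
`Extension ↦ cls ∈ J⁰Hom(A, B) = Hom_ℂ/(F⁰Hom + Hom_ℚ)` is **surjective** (`cls_surjective`),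
one half of Carlson's Prop. 2 (`Ext(A, B) ≅ J⁰Hom(A, B)`; Peters–Steenbrink Thm. 3.31). With
`ψ = 0` this is the split extension `A ⊕ B` (direct sum of MHS, Cattani et al. Ex. 3.2.23 (2)).

## Main definitions and results

* `MixedHodgeStructure.twist ψ` — the unipotent automorphism `(x, y) ↦ (x, y + ψ x)` of
  `A_ℂ × B_ℂ`; `twProd FA FB ψ = g(ψ)(FA × FB)`; `conjHom ψ = conj ∘ ψ ∘ conj`.
* `MixedHodgeStructure.prodW A B k = W_k A × W_k B`, `twistF A B ψ p` (on `ℂ ⊗ (VA × VB)`, via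
  `HodgeStructure.prodEquiv`), `baseChange_prod`.
* `MixedHodgeStructure.twisted A B hsep ψ : MixedHodgeStructure (VA × VB)` — Carlson's `E_ψ`.
* `MixedHodgeStructure.twistedExtension A B hsep ψ : Extension A B (VA × VB)` and
  `cls_twistedExtension : (twistedExtension A B hsep ψ).cls = JHom.mk A B ψ`;
  `Extension.cls_surjective`.

## References

* [Carlson1980] J. A. Carlson, Extensions of mixed Hodge structures, Journées de géométrie
  algébrique d'Angers 1979, Sijthoff & Noordhoff (1980), 107–127, §2(b), Prop. 2 and its proof
  (normalized extensions, `g(ψ)`).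
* [CattaniElZeinGriffithsLe2014] E. Cattani et al. (eds.), Hodge Theory (2014), Ex. 3.2.23 (2)
  (direct sums of MHS), Thm. 8.4.2 (Carlson's theorem).
-/

open scoped TensorProduct

noncomputable section

namespace Literature.AlgebraicGeometry.Motives

namespace MixedHodgeStructure

universe u v w

variable {VA : Type u} [AddCommGroup VA] [Module ℚ VA]
variable {VB : Type v} [AddCommGroup VB] [Module ℚ VB]

open HodgeStructure (conj complexConj conj_conj conj_smul prodEquiv)

/-! ### The conjugate of a `ℂ`-linear map and Carlson's twist `g(ψ)` -/

/-- The complex conjugate `conj ∘ ψ ∘ conj` of a `ℂ`-linear map between complexifications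
(again `ℂ`-linear). [folklore] -/
def conjHom (ψ : ℂ ⊗[ℚ] VA →ₗ[ℂ] ℂ ⊗[ℚ] VB) : ℂ ⊗[ℚ] VA →ₗ[ℂ] ℂ ⊗[ℚ] VB where
  toFun x := conj (ψ (conj x))
  map_add' x y := by simp [map_add]
  map_smul' c x := by
    simp only [conj_smul, map_smul, RingHom.id_apply, starRingEnd_self_apply]

/-- `conjHom ψ x = conj (ψ (conj x))`. [folklore] -/
@[simp]
theorem conjHom_apply (ψ : ℂ ⊗[ℚ] VA →ₗ[ℂ] ℂ ⊗[ℚ] VB) (x : ℂ ⊗[ℚ] VA) :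
    conjHom ψ x = conj (ψ (conj x)) := rfl

/-- **Carlson's twist** `g(ψ) = (1 0; ψ 1)`: the unipotent automorphism `(x, y) ↦ (x, y + ψ x)` of
`A_ℂ × B_ℂ` (Carlson 1980, proof of Prop. 2, there `g(ψ) = (1_A ψ; 0 1_B)` on `A ⊕ B` with the
sub `A` first). [cite: Carlson1980, Prop. 2] -/
def twist (ψ : ℂ ⊗[ℚ] VA →ₗ[ℂ] ℂ ⊗[ℚ] VB) :
    ((ℂ ⊗[ℚ] VA) × (ℂ ⊗[ℚ] VB)) ≃ₗ[ℂ] (ℂ ⊗[ℚ] VA) × (ℂ ⊗[ℚ] VB) :=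
  (LinearEquiv.refl ℂ _).skewProd (LinearEquiv.refl ℂ _) ψ

/-- `g(ψ)(x, y) = (x, y + ψ x)`. [folklore] -/
@[simp]
theorem twist_apply (ψ : ℂ ⊗[ℚ] VA →ₗ[ℂ] ℂ ⊗[ℚ] VB) (z : (ℂ ⊗[ℚ] VA) × (ℂ ⊗[ℚ] VB)) :
    twist ψ z = (z.1, z.2 + ψ z.1) := by
  simp [twist]

/-- `g(ψ)⁻¹(x, y) = (x, y - ψ x)`. [folklore] -/
@[simp]
theorem twist_symm_apply (ψ : ℂ ⊗[ℚ] VA →ₗ[ℂ] ℂ ⊗[ℚ] VB) (z : (ℂ ⊗[ℚ] VA) × (ℂ ⊗[ℚ] VB)) :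
    (twist ψ).symm z = (z.1, z.2 - ψ z.1) := by
  simp [twist]

/-- The twisted product `g(ψ)(FA × FB) = {(x, y) | x ∈ FA, y - ψ x ∈ FB}`. [folklore] -/
def twProd (FA : Submodule ℂ (ℂ ⊗[ℚ] VA)) (FB : Submodule ℂ (ℂ ⊗[ℚ] VB))
    (ψ : ℂ ⊗[ℚ] VA →ₗ[ℂ] ℂ ⊗[ℚ] VB) : Submodule ℂ ((ℂ ⊗[ℚ] VA) × (ℂ ⊗[ℚ] VB)) :=
  (FA.prod FB).map (twist ψ : _ →ₗ[ℂ] _)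

/-- Membership in the twisted product. [folklore] -/
theorem mem_twProd_iff {FA : Submodule ℂ (ℂ ⊗[ℚ] VA)} {FB : Submodule ℂ (ℂ ⊗[ℚ] VB)}
    {ψ : ℂ ⊗[ℚ] VA →ₗ[ℂ] ℂ ⊗[ℚ] VB} {z : (ℂ ⊗[ℚ] VA) × (ℂ ⊗[ℚ] VB)} :
    z ∈ twProd FA FB ψ ↔ z.1 ∈ FA ∧ z.2 - ψ z.1 ∈ FB := by
  rw [twProd, Submodule.mem_map_equiv, twist_symm_apply, Submodule.mem_prod]

/-- **The twist acts trivially on the graded pieces** (lattice form). If `ψ` maps `WA` into `WB'`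
(with `WB' ≤ WB`; `WA'` arbitrary), then
`(g(ψ)(FA × FB) ∩ (WA × WB)) + (WA' × WB') = ((FA ∩ WA) + WA') × ((FB ∩ WB) + WB')`
(Carlson 1980, proof of Prop. 2: by separation the weight filtration of a normalized extension
is the direct-sum one, and `Gr^W` does not see `ψ`). [folklore] -/
theorem twProd_inf_prod_sup_prod {FA WA WA' : Submodule ℂ (ℂ ⊗[ℚ] VA)}
    {FB WB WB' : Submodule ℂ (ℂ ⊗[ℚ] VB)} {ψ : ℂ ⊗[ℚ] VA →ₗ[ℂ] ℂ ⊗[ℚ] VB}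
    (hB : WB' ≤ WB) (hψ : ∀ x ∈ WA, ψ x ∈ WB') :
    (twProd FA FB ψ ⊓ WA.prod WB) ⊔ WA'.prod WB' = ((FA ⊓ WA) ⊔ WA').prod ((FB ⊓ WB) ⊔ WB') := by
  apply le_antisymm
  · refine sup_le ?_ (Submodule.prod_mono le_sup_right le_sup_right)
    rintro ⟨x, y⟩ ⟨hF, hW⟩
    rw [SetLike.mem_coe, mem_twProd_iff] at hF
    obtain ⟨hxW, hyW⟩ := (Submodule.mem_prod).1 hW
    refine (Submodule.mem_prod).2 ⟨Submodule.mem_sup_left ⟨hF.1, hxW⟩, ?_⟩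
    have hψx : ψ x ∈ WB' := hψ x hxW
    rw [show y = (y - ψ x) + ψ x by abel]
    exact Submodule.add_mem_sup ⟨hF.2, WB.sub_mem hyW (hB hψx)⟩ hψx
  · rintro ⟨u, v⟩ huv
    obtain ⟨hu, hv⟩ := (Submodule.mem_prod).1 huv
    obtain ⟨u₁, hu₁, u₂, hu₂, rfl⟩ := Submodule.mem_sup.1 hu
    obtain ⟨v₁, hv₁, v₂, hv₂, rfl⟩ := Submodule.mem_sup.1 hv
    have hψu : ψ u₁ ∈ WB' := hψ u₁ hu₁.2
    have he : ((u₁ + u₂, v₁ + v₂) : (ℂ ⊗[ℚ] VA) × (ℂ ⊗[ℚ] VB)) =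
        (u₁, v₁ + ψ u₁) + (u₂, v₂ - ψ u₁) := by
      ext <;> simp
    rw [he]
    refine Submodule.add_mem_sup ⟨?_, ?_⟩ ((Submodule.mem_prod).2 ⟨hu₂, WB'.sub_mem hv₂ hψu⟩)
    · rw [SetLike.mem_coe, mem_twProd_iff]
      exact ⟨hu₁.1, by simpa using hv₁.1⟩
    · exact (Submodule.mem_prod).2 ⟨hu₁.2, WB.add_mem hv₁.2 (hB hψu)⟩

/-! ### Base change of products -/

/-- `prodEquiv⁻¹ (c ⊗ a, 0) = c ⊗ (a, 0)`. [folklore] -/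
theorem prodEquiv_symm_tmul_zero (c : ℂ) (a : VA) :
    (prodEquiv VA VB).symm (c ⊗ₜ[ℚ] a, 0) = c ⊗ₜ[ℚ] (a, (0 : VB)) := by
  rw [LinearEquiv.symm_apply_eq]
  simp [HodgeStructure.prodEquiv]

/-- `prodEquiv⁻¹ (0, c ⊗ b) = c ⊗ (0, b)`. [folklore] -/
theorem prodEquiv_symm_zero_tmul (c : ℂ) (b : VB) :
    (prodEquiv VA VB).symm (0, c ⊗ₜ[ℚ] b) = c ⊗ₜ[ℚ] ((0 : VA), b) := by
  rw [LinearEquiv.symm_apply_eq]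
  simp [HodgeStructure.prodEquiv]

/-- **Base change of a product of subspaces**: `(P × Q)_ℂ` corresponds to `P_ℂ × Q_ℂ` under
`ℂ ⊗ (VA × VB) ≅ (ℂ ⊗ VA) × (ℂ ⊗ VB)`. [folklore] -/
theorem baseChange_prod (P : Submodule ℚ VA) (Q : Submodule ℚ VB) :
    (P.prod Q).baseChange ℂ =
      ((P.baseChange ℂ).prod (Q.baseChange ℂ)).comap (prodEquiv VA VB : ℂ ⊗[ℚ] (VA × VB) →ₗ[ℂ] _) := by
  apply le_antisymm
  · rw [Submodule.baseChange_eq_span, Submodule.span_le]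
    rintro _ ⟨⟨a, b⟩, hab, rfl⟩
    obtain ⟨ha, hb⟩ := (Submodule.mem_prod).1 hab
    simp only [SetLike.mem_coe, Submodule.mem_comap, LinearEquiv.coe_coe, Submodule.mem_prod]
    simp [HodgeStructure.prodEquiv, Submodule.tmul_mem_baseChange_of_mem, ha, hb]
  · intro z hz
    rw [Submodule.mem_comap, LinearEquiv.coe_coe, Submodule.mem_prod] at hz
    obtain ⟨hu, hv⟩ := hz
    have hz' : z = (prodEquiv VA VB).symm ((prodEquiv VA VB z).1, 0) +
        (prodEquiv VA VB).symm (0, (prodEquiv VA VB z).2) := by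
      rw [← map_add, Prod.mk_add_mk, add_zero, zero_add, Prod.mk.eta, LinearEquiv.symm_apply_apply]
    rw [hz']
    refine Submodule.add_mem _ ?_ ?_
    · obtain ⟨w, hw⟩ := hu
      rw [← hw]
      clear hw
      induction w using TensorProduct.induction_on with
      | zero => simp [← Prod.zero_eq_mk]
      | tmul c a =>
        rw [LinearMap.baseChange_tmul, Submodule.subtype_apply, prodEquiv_symm_tmul_zero]
        exact Submodule.tmul_mem_baseChange_of_mem c ((Submodule.mem_prod).2 ⟨a.2, Q.zero_mem⟩)
      | add x y hx hy =>
        rw [map_add, show ((P.subtype.baseChange ℂ x + P.subtype.baseChange ℂ y, 0) :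
            (ℂ ⊗[ℚ] VA) × (ℂ ⊗[ℚ] VB)) = (P.subtype.baseChange ℂ x, 0) + (P.subtype.baseChange ℂ y, 0)
            by simp, map_add]
        exact Submodule.add_mem _ hx hy
    · obtain ⟨w, hw⟩ := hv
      rw [← hw]
      clear hw
      induction w using TensorProduct.induction_on with
      | zero => simp [← Prod.zero_eq_mk]
      | tmul c b =>
        rw [LinearMap.baseChange_tmul, Submodule.subtype_apply, prodEquiv_symm_zero_tmul]
        exact Submodule.tmul_mem_baseChange_of_mem c ((Submodule.mem_prod).2 ⟨P.zero_mem, b.2⟩)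
      | add x y hx hy =>
        rw [map_add, show ((0, Q.subtype.baseChange ℂ x + Q.subtype.baseChange ℂ y) :
            (ℂ ⊗[ℚ] VA) × (ℂ ⊗[ℚ] VB)) = (0, Q.subtype.baseChange ℂ x) + (0, Q.subtype.baseChange ℂ y)
            by simp, map_add]
        exact Submodule.add_mem _ hx hy

/-- `prodEquiv` intertwines complex conjugation with componentwise conjugation. [folklore] -/
theorem prodEquiv_conj (z : ℂ ⊗[ℚ] (VA × VB)) :
    prodEquiv VA VB (conj z) = (conj (prodEquiv VA VB z).1, conj (prodEquiv VA VB z).2) := by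
  rw [← LinearEquiv.eq_symm_apply, ← HodgeStructure.conj_prodEquiv_symm, Prod.mk.eta,
    LinearEquiv.symm_apply_apply]

/-- Conjugation of a pulled-back twisted product: `conj` of `g(ψ)(FA × FB)` is
`g(conj ψ conj)(conj FA × conj FB)`. [folklore] -/
theorem complexConj_comap_twProd (FA : Submodule ℂ (ℂ ⊗[ℚ] VA)) (FB : Submodule ℂ (ℂ ⊗[ℚ] VB))
    (ψ : ℂ ⊗[ℚ] VA →ₗ[ℂ] ℂ ⊗[ℚ] VB) :
    complexConj ((twProd FA FB ψ).comap (prodEquiv VA VB : ℂ ⊗[ℚ] (VA × VB) →ₗ[ℂ] _)) =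
      (twProd (complexConj FA) (complexConj FB) (conjHom ψ)).comap (prodEquiv VA VB : ℂ ⊗[ℚ] (VA × VB) →ₗ[ℂ] _) := by
  ext z
  simp only [HodgeStructure.mem_complexConj, Submodule.mem_comap, LinearEquiv.coe_coe, mem_twProd_iff,
    prodEquiv_conj, conjHom_apply, conj_conj, map_sub]

/-! ### Carlson's normalized extension `E_ψ` -/

section Twisted

variable (A : MixedHodgeStructure VA) (B : MixedHodgeStructure VB)

/-- The direct-sum weight filtration `W_k = W_k A × W_k B` on `VA × VB` (Carlson 1980, proof of
Prop. 2: "`W_m L_ℚ = W_m A_ℚ ⊕ W_m B_ℚ` is the only choice"). [cite: Carlson1980, Prop. 2] -/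
def prodW (k : ℤ) : Submodule ℚ (VA × VB) :=
  (A.W k).prod (B.W k)

/-- The twisted Hodge filtration `F^p_ψ = g(ψ)(F^p A × F^p B)` on `ℂ ⊗ (VA × VB)`
(Carlson 1980, proof of Prop. 2). [cite: Carlson1980, Prop. 2] -/
def twistF (ψ : ℂ ⊗[ℚ] VA →ₗ[ℂ] ℂ ⊗[ℚ] VB) (p : ℤ) : Submodule ℂ (ℂ ⊗[ℚ] (VA × VB)) :=
  (twProd (A.F p) (B.F p) ψ).comap (prodEquiv VA VB : ℂ ⊗[ℚ] (VA × VB) →ₗ[ℂ] _)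

/-- Membership in `F^p_ψ`: `(x, y)` with `x ∈ F^p A` and `y - ψ x ∈ F^p B`. [folklore] -/
theorem mem_twistF_iff (ψ : ℂ ⊗[ℚ] VA →ₗ[ℂ] ℂ ⊗[ℚ] VB) (p : ℤ) (z : ℂ ⊗[ℚ] (VA × VB)) :
    z ∈ twistF A B ψ p ↔ (prodEquiv VA VB z).1 ∈ A.F p ∧
      (prodEquiv VA VB z).2 - ψ (prodEquiv VA VB z).1 ∈ B.F p := by
  rw [twistF, Submodule.mem_comap, LinearEquiv.coe_coe, mem_twProd_iff]

variable {A B}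

/-- In a separated pair, every `ψ : A_ℂ → B_ℂ` maps `W_k A_ℂ` into `W_{k-1} B_ℂ` (either
`W_k A = 0` or `W_{k-1} B = B`). [folklore] -/
theorem map_baseChange_W_le_of_isSeparated (hsep : IsSeparated A B)
    (ψ : ℂ ⊗[ℚ] VA →ₗ[ℂ] ℂ ⊗[ℚ] VB) (k : ℤ) :
    ∀ x ∈ (A.W k).baseChange ℂ, ψ x ∈ (B.W (k - 1)).baseChange ℂ := by
  obtain ⟨m, hBm, hAm⟩ := hsep
  intro x hx
  rcases le_or_gt k m with hk | hk
  · have hAk : A.W k = ⊥ := eq_bot_iff.2 (hAm ▸ A.monotone_W hk)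
    rw [hAk, Submodule.baseChange_bot, Submodule.mem_bot] at hx
    simp [hx]
  · have hBk : B.W (k - 1) = ⊤ := eq_top_iff.2 (hBm ▸ B.monotone_W (by omega))
    simp [hBk]

variable (A B)

/-- **Carlson's normalized extension `E_ψ` is a mixed Hodge structure** (for separated `A`, `B`):
`VA × VB` with `W_k = W_k A × W_k B` and `F^p = g(ψ)(F^p A × F^p B)` (Carlson 1980, proof of
Prop. 2). On each `Gr^W_k` the twist is invisible (`twProd_inf_prod_sup_prod`), so the axiom
reduces to those of `A` and `B`; with `ψ = 0` this is the direct sum `A ⊕ B` (Cattani et al.,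
Ex. 3.2.23 (2)). [cite: Carlson1980, Prop. 2] -/
def twisted (hsep : IsSeparated A B) (ψ : ℂ ⊗[ℚ] VA →ₗ[ℂ] ℂ ⊗[ℚ] VB) :
    MixedHodgeStructure (VA × VB) where
  W := prodW A B
  monotone_W _ _ h := Submodule.prod_mono (A.monotone_W h) (B.monotone_W h)
  exists_W_eq_bot := by
    obtain ⟨m, hBm, hAm⟩ := hsep
    obtain ⟨k, hk⟩ := B.exists_W_eq_bot
    refine ⟨min k m, ?_⟩
    have hA0 : A.W (min k m) = ⊥ := eq_bot_iff.2 (hAm ▸ A.monotone_W (min_le_right k m))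
    have hB0 : B.W (min k m) = ⊥ := eq_bot_iff.2 (hk ▸ B.monotone_W (min_le_left k m))
    rw [prodW, hA0, hB0, Submodule.prod_bot]
  exists_W_eq_top := by
    obtain ⟨m, hBm, hAm⟩ := hsep
    obtain ⟨k, hk⟩ := A.exists_W_eq_top
    refine ⟨max k m, ?_⟩
    have hA1 : A.W (max k m) = ⊤ := eq_top_iff.2 (hk ▸ A.monotone_W (le_max_left k m))
    have hB1 : B.W (max k m) = ⊤ := eq_top_iff.2 (hBm ▸ B.monotone_W (le_max_right k m))
    rw [prodW, hA1, hB1, Submodule.prod_top]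
  F := twistF A B ψ
  antitone_F _ _ h := Submodule.comap_mono (Submodule.map_mono (Submodule.prod_mono
    (A.antitone_F h) (B.antitone_F h)))
  exists_F_eq_top := by
    obtain ⟨p₁, h₁⟩ := A.exists_F_eq_top
    obtain ⟨p₂, h₂⟩ := B.exists_F_eq_top
    refine ⟨min p₁ p₂, eq_top_iff.2 fun z _ => ?_⟩
    have hA1 : A.F (min p₁ p₂) = ⊤ := eq_top_iff.2 (h₁ ▸ A.antitone_F (min_le_left p₁ p₂))
    have hB1 : B.F (min p₁ p₂) = ⊤ := eq_top_iff.2 (h₂ ▸ B.antitone_F (min_le_right p₁ p₂))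
    rw [mem_twistF_iff, hA1, hB1]
    exact ⟨trivial, trivial⟩
  exists_F_eq_bot := by
    obtain ⟨p₁, h₁⟩ := A.exists_F_eq_bot
    obtain ⟨p₂, h₂⟩ := B.exists_F_eq_bot
    refine ⟨max p₁ p₂, eq_bot_iff.2 fun z hz => ?_⟩
    have hA0 : A.F (max p₁ p₂) = ⊥ := eq_bot_iff.2 (h₁ ▸ A.antitone_F (le_max_left p₁ p₂))
    have hB0 : B.F (max p₁ p₂) = ⊥ := eq_bot_iff.2 (h₂ ▸ B.antitone_F (le_max_right p₁ p₂))
    rw [mem_twistF_iff, hA0, hB0, Submodule.mem_bot, Submodule.mem_bot] at hz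
    obtain ⟨h1, h2⟩ := hz
    rw [h1, map_zero, sub_zero] at h2
    rw [Submodule.mem_bot, ← (prodEquiv VA VB).map_eq_zero_iff, Prod.ext_iff]
    exact ⟨h1, h2⟩
  isCompl_grF k p q hpq := by
    rw [isCompl_grF_iff, inf_pred_eq_of_monotone (W := prodW A B)
      (fun _ _ h => Submodule.prod_mono (A.monotone_W h) (B.monotone_W h))]
    have hψ := map_baseChange_W_le_of_isSeparated hsep ψ k
    have hψ' : ∀ x ∈ (A.W k).baseChange ℂ, conjHom ψ x ∈ (B.W (k - 1)).baseChange ℂ := by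
      intro x hx
      rw [conjHom_apply, ← HodgeStructure.mem_complexConj, complexConj_baseChange]
      refine hψ _ ?_
      rw [← HodgeStructure.mem_complexConj, complexConj_baseChange]
      exact hx
    obtain ⟨hA1, hA2⟩ := A.grOpposed k p q hpq
    obtain ⟨hB1, hB2⟩ := B.grOpposed k p q hpq
    have hWB : (B.W (k - 1)).baseChange ℂ ≤ (B.W k).baseChange ℂ :=
      Submodule.baseChange_mono ℂ (B.monotone_W (by omega))
    have key := twProd_inf_prod_sup_prod (FA := A.F p) (FB := B.F p)
      (WA' := (A.W (k - 1)).baseChange ℂ) hWB hψ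
    have key' := twProd_inf_prod_sup_prod (FA := complexConj (A.F q)) (FB := complexConj (B.F q))
      (WA' := (A.W (k - 1)).baseChange ℂ) hWB hψ'
    -- the two conditions in the product model `A_ℂ × B_ℂ`
    have h1 : ((twProd (A.F p) (B.F p) ψ ⊓ ((A.W k).baseChange ℂ).prod ((B.W k).baseChange ℂ)) ⊔
          ((A.W (k - 1)).baseChange ℂ).prod ((B.W (k - 1)).baseChange ℂ)) ⊓
        ((twProd (complexConj (A.F q)) (complexConj (B.F q)) (conjHom ψ) ⊓
            ((A.W k).baseChange ℂ).prod ((B.W k).baseChange ℂ)) ⊔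
          ((A.W (k - 1)).baseChange ℂ).prod ((B.W (k - 1)).baseChange ℂ)) =
        ((A.W (k - 1)).baseChange ℂ).prod ((B.W (k - 1)).baseChange ℂ) := by
      rw [key, key', Submodule.prod_inf_prod, hA1, hB1]
    have h2 : (twProd (A.F p) (B.F p) ψ ⊓ ((A.W k).baseChange ℂ).prod ((B.W k).baseChange ℂ)) ⊔
          (twProd (complexConj (A.F q)) (complexConj (B.F q)) (conjHom ψ) ⊓
            ((A.W k).baseChange ℂ).prod ((B.W k).baseChange ℂ)) ⊔
          ((A.W (k - 1)).baseChange ℂ).prod ((B.W (k - 1)).baseChange ℂ) =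
        ((A.W k).baseChange ℂ).prod ((B.W k).baseChange ℂ) := by
      rw [← sup_idem (((A.W (k - 1)).baseChange ℂ).prod ((B.W (k - 1)).baseChange ℂ)),
        ← sup_sup_sup_comm, key, key', Submodule.prod_sup_prod, sup_sup_sup_comm, sup_idem,
        sup_sup_sup_comm, sup_idem, hA2, hB2]
    -- pull back along `prodEquiv`: `comap e = map e⁻¹` commutes with `⊓` and `⊔`
    have hinj : Function.Injective
        ((prodEquiv VA VB).symm : (ℂ ⊗[ℚ] VA) × (ℂ ⊗[ℚ] VB) →ₗ[ℂ] ℂ ⊗[ℚ] (VA × VB)) :=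
      (prodEquiv VA VB).symm.injective
    simp only [prodW, twistF, baseChange_prod, complexConj_comap_twProd]
    simp only [Submodule.comap_equiv_eq_map_symm, ← Submodule.map_inf _ hinj, ← Submodule.map_sup]
    exact ⟨congrArg _ h1, congrArg _ h2⟩

/-- The weight filtration of `E_ψ` is the direct-sum one (by `rfl`). [folklore] -/
@[simp]
theorem twisted_W (hsep : IsSeparated A B) (ψ : ℂ ⊗[ℚ] VA →ₗ[ℂ] ℂ ⊗[ℚ] VB) (k : ℤ) :
    (twisted A B hsep ψ).W k = (A.W k).prod (B.W k) := rfl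

/-- The Hodge filtration of `E_ψ` is the twisted one (by `rfl`). [folklore] -/
@[simp]
theorem twisted_F (hsep : IsSeparated A B) (ψ : ℂ ⊗[ℚ] VA →ₗ[ℂ] ℂ ⊗[ℚ] VB) (p : ℤ) :
    (twisted A B hsep ψ).F p = twistF A B ψ p := rfl

/-! ### `prodEquiv` and the structure maps of `VA × VB` -/

omit [AddCommGroup VA] [Module ℚ VA] [AddCommGroup VB] [Module ℚ VB] in
/-- `prodEquiv (inr ⊗ 1) y = (0, y)`. [folklore] -/
theorem prodEquiv_inr_baseChange {VA : Type u} [AddCommGroup VA] [Module ℚ VA] {VB : Type v}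
    [AddCommGroup VB] [Module ℚ VB] (y : ℂ ⊗[ℚ] VB) :
    prodEquiv VA VB ((LinearMap.inr ℚ VA VB).baseChange ℂ y) = (0, y) := by
  induction y using TensorProduct.induction_on with
  | zero => simp only [map_zero]; rfl
  | tmul c b => simp [HodgeStructure.prodEquiv]
  | add x y hx hy => rw [map_add, map_add, hx, hy, Prod.mk_add_mk, add_zero]

omit [AddCommGroup VA] [Module ℚ VA] [AddCommGroup VB] [Module ℚ VB] in
/-- `prodEquiv (inl ⊗ 1) x = (x, 0)`. [folklore] -/
theorem prodEquiv_inl_baseChange {VA : Type u} [AddCommGroup VA] [Module ℚ VA] {VB : Type v}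
    [AddCommGroup VB] [Module ℚ VB] (x : ℂ ⊗[ℚ] VA) :
    prodEquiv VA VB ((LinearMap.inl ℚ VA VB).baseChange ℂ x) = (x, 0) := by
  induction x using TensorProduct.induction_on with
  | zero => simp only [map_zero]; rfl
  | tmul c a => simp [HodgeStructure.prodEquiv]
  | add x y hx hy => rw [map_add, map_add, hx, hy, Prod.mk_add_mk, add_zero]

omit [AddCommGroup VA] [Module ℚ VA] [AddCommGroup VB] [Module ℚ VB] in
/-- `(fst ⊗ 1) z = (prodEquiv z).1`. [folklore] -/
theorem fst_baseChange_apply {VA : Type u} [AddCommGroup VA] [Module ℚ VA] {VB : Type v}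
    [AddCommGroup VB] [Module ℚ VB] (z : ℂ ⊗[ℚ] (VA × VB)) :
    (LinearMap.fst ℚ VA VB).baseChange ℂ z = (prodEquiv VA VB z).1 := by
  induction z using TensorProduct.induction_on with
  | zero => simp
  | tmul c ab => simp [HodgeStructure.prodEquiv]
  | add x y hx hy => rw [map_add, map_add, hx, hy, Prod.fst_add]

omit [AddCommGroup VA] [Module ℚ VA] [AddCommGroup VB] [Module ℚ VB] in
/-- The range of `inr` is `0 × VB`. [folklore] -/
theorem range_inr_eq_prod {R : Type*} [Ring R] {M N : Type*} [AddCommGroup M] [Module R M]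
    [AddCommGroup N] [Module R N] :
    LinearMap.range (LinearMap.inr R M N) = Submodule.prod ⊥ ⊤ := by
  rw [LinearMap.range_inr, ← Submodule.comap_bot, Submodule.comap_fst]

/-! ### The normalized extension `0 → B → E_ψ → A → 0` -/

/-- `inr : B → E_ψ` is a morphism of mixed Hodge structures. [folklore] -/
theorem isHom_inr_twisted (hsep : IsSeparated A B) (ψ : ℂ ⊗[ℚ] VA →ₗ[ℂ] ℂ ⊗[ℚ] VB) :
    IsHom B (twisted A B hsep ψ) (LinearMap.inr ℚ VA VB) := by
  refine ⟨fun k => ?_, fun p => ?_⟩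
  · rw [twisted_W, Submodule.map_inr]
    exact Submodule.prod_mono bot_le le_rfl
  · rintro _ ⟨y, hy, rfl⟩
    rw [twisted_F, mem_twistF_iff, prodEquiv_inr_baseChange]
    simpa using hy

/-- `fst : E_ψ → A` is a morphism of mixed Hodge structures. [folklore] -/
theorem isHom_fst_twisted (hsep : IsSeparated A B) (ψ : ℂ ⊗[ℚ] VA →ₗ[ℂ] ℂ ⊗[ℚ] VB) :
    IsHom (twisted A B hsep ψ) A (LinearMap.fst ℚ VA VB) := by
  refine ⟨fun k => ?_, fun p => ?_⟩
  · rw [twisted_W, Submodule.prod_map_fst]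
  · rintro _ ⟨z, hz, rfl⟩
    rw [SetLike.mem_coe, twisted_F, mem_twistF_iff] at hz
    rw [fst_baseChange_apply]
    exact hz.1

/-- **Carlson's normalized extension** `0 → B —inr→ E_ψ —fst→ A → 0` (Carlson 1980, proof of
Prop. 2: "a normalized extension of `B` by `A` is one with underlying lattice `A_ℤ ⊕ B_ℤ`" with
Hodge filtration `g(ψ)(F·A ⊕ F·B)`); here over `ℚ`, for separated `A`, `B`. Strictness of `inr`
and `fst` holds by construction (`F^p_ψ ∩ B_ℂ = F^p B`, `fst(F^p_ψ) = F^p A`). [cite: Carlson1980, Prop. 2] -/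
def twistedExtension (hsep : IsSeparated A B) (ψ : ℂ ⊗[ℚ] VA →ₗ[ℂ] ℂ ⊗[ℚ] VB) :
    Extension A B (VA × VB) where
  mhs := twisted A B hsep ψ
  inc := Hom.ofIsHom (isHom_inr_twisted A B hsep ψ)
  proj := Hom.ofIsHom (isHom_fst_twisted A B hsep ψ)
  injective_inc := LinearMap.inr_injective
  surjective_proj := LinearMap.fst_surjective
  exact := Function.Exact.inr_fst
  isStrict_inc :=
    { map_W := fun k => by
        change (B.W k).map (LinearMap.inr ℚ VA VB) =
          (A.W k).prod (B.W k) ⊓ LinearMap.range (LinearMap.inr ℚ VA VB)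
        rw [Submodule.map_inr, range_inr_eq_prod, Submodule.prod_inf_prod, inf_bot_eq, inf_top_eq]
      map_F := fun p => by
        change (B.F p).map ((LinearMap.inr ℚ VA VB).baseChange ℂ) =
          twistF A B ψ p ⊓ LinearMap.range ((LinearMap.inr ℚ VA VB).baseChange ℂ)
        refine le_antisymm (le_inf ((isHom_inr_twisted A B hsep ψ).map_F_le p)
          (LinearMap.map_le_range)) ?_
        rintro _ ⟨hz, y, rfl⟩
        rw [SetLike.mem_coe, mem_twistF_iff, prodEquiv_inr_baseChange] at hz
        refine ⟨y, ?_, rfl⟩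
        simpa using hz.2 }
  isStrict_proj :=
    { map_W := fun k => by
        change ((A.W k).prod (B.W k)).map (LinearMap.fst ℚ VA VB) =
          A.W k ⊓ LinearMap.range (LinearMap.fst ℚ VA VB)
        rw [Submodule.prod_map_fst, Submodule.range_fst, inf_top_eq]
      map_F := fun p => by
        change (twistF A B ψ p).map ((LinearMap.fst ℚ VA VB).baseChange ℂ) =
          A.F p ⊓ LinearMap.range ((LinearMap.fst ℚ VA VB).baseChange ℂ)
        rw [LinearMap.range_eq_top.2 (LinearMap.baseChange_surjective ℂ LinearMap.fst_surjective),
          inf_top_eq]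
        refine le_antisymm ((isHom_fst_twisted A B hsep ψ).map_F_le p) fun x hx => ?_
        refine ⟨(prodEquiv VA VB).symm (x, ψ x), ?_, ?_⟩
        · rw [SetLike.mem_coe, mem_twistF_iff, LinearEquiv.apply_symm_apply]
          simpa using hx
        · rw [fst_baseChange_apply, LinearEquiv.apply_symm_apply] }

/-- The middle MHS of the normalized extension is `E_ψ` (by `rfl`). [folklore] -/
@[simp]
theorem twistedExtension_mhs (hsep : IsSeparated A B) (ψ : ℂ ⊗[ℚ] VA →ₗ[ℂ] ℂ ⊗[ℚ] VB) :
    (twistedExtension A B hsep ψ).mhs = twisted A B hsep ψ := rfl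

/-- The inclusion of the normalized extension is `inr` (by `rfl`). [folklore] -/
@[simp]
theorem twistedExtension_inc (hsep : IsSeparated A B) (ψ : ℂ ⊗[ℚ] VA →ₗ[ℂ] ℂ ⊗[ℚ] VB) :
    (twistedExtension A B hsep ψ).inc.toLinearMap = LinearMap.inr ℚ VA VB := rfl

/-- The projection of the normalized extension is `fst` (by `rfl`). [folklore] -/
@[simp]
theorem twistedExtension_proj (hsep : IsSeparated A B) (ψ : ℂ ⊗[ℚ] VA →ₗ[ℂ] ℂ ⊗[ℚ] VB) :
    (twistedExtension A B hsep ψ).proj.toLinearMap = LinearMap.fst ℚ VA VB := rfl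

/-- The **Hodge section** `x ↦ (x, ψ x) = (x, 0) + (0, ψ x)` of the normalized extension (it is
`g(ψ)` composed with the obvious section of `A_ℂ ⊕ B_ℂ → A_ℂ`). [folklore] -/
def twistedHodgeSection (hsep : IsSeparated A B) (ψ : ℂ ⊗[ℚ] VA →ₗ[ℂ] ℂ ⊗[ℚ] VB) :
    (twistedExtension A B hsep ψ).HodgeSection where
  toLinearMap := ((prodEquiv VA VB).symm : (ℂ ⊗[ℚ] VA) × (ℂ ⊗[ℚ] VB) →ₗ[ℂ] ℂ ⊗[ℚ] (VA × VB)) ∘ₗ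
    (LinearMap.inl ℂ _ _ + LinearMap.inr ℂ _ _ ∘ₗ ψ)
  projC_comp := by
    refine LinearMap.ext fun x => ?_
    rw [LinearMap.comp_apply, Extension.projC, twistedExtension_proj, fst_baseChange_apply,
      LinearMap.comp_apply, LinearEquiv.coe_coe, LinearEquiv.apply_symm_apply]
    simp
  map_F_le p := by
    rintro _ ⟨x, hx, rfl⟩
    rw [twistedExtension_mhs, twisted_F, mem_twistF_iff, LinearMap.comp_apply,
      LinearEquiv.coe_coe, LinearEquiv.apply_symm_apply]
    simpa using hx

/-- The **rational section** `inl : a ↦ (a, 0)` of the normalized extension. [folklore] -/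
def twistedRatSection (hsep : IsSeparated A B) (ψ : ℂ ⊗[ℚ] VA →ₗ[ℂ] ℂ ⊗[ℚ] VB) :
    (twistedExtension A B hsep ψ).RatSection :=
  ⟨LinearMap.inl ℚ VA VB, by rw [twistedExtension_proj]; exact LinearMap.fst_comp_inl ℚ VA VB⟩

/-- **The representing homomorphism of `E_ψ` is `ψ`**: `(x, ψ x) - (x, 0) = inr (ψ x)`
(Carlson 1980, proof of Prop. 2 / Lemma 4: `ψ = r ∘ s_F`). [cite: Carlson1980, Lemma 4] -/
theorem reprHom_twistedExtension (hsep : IsSeparated A B) (ψ : ℂ ⊗[ℚ] VA →ₗ[ℂ] ℂ ⊗[ℚ] VB) :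
    (twistedExtension A B hsep ψ).reprHom (twistedHodgeSection A B hsep ψ)
      (twistedRatSection A B hsep ψ) = ψ := by
  have hF : ∀ x, (twistedHodgeSection A B hsep ψ).toLinearMap x =
      (prodEquiv VA VB).symm ((x, 0) + (0, ψ x)) := fun x => rfl
  have hQ : (twistedRatSection A B hsep ψ).toLinearMap = LinearMap.inl ℚ VA VB := rfl
  have hI : (twistedExtension A B hsep ψ).incC = (LinearMap.inr ℚ VA VB).baseChange ℂ := rfl
  refine LinearMap.ext fun x => (twistedExtension A B hsep ψ).injective_incC ?_
  rw [Extension.incC_reprHom, hF, hQ, hI]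
  apply (prodEquiv VA VB).injective
  rw [map_sub, LinearEquiv.apply_symm_apply, prodEquiv_inl_baseChange, prodEquiv_inr_baseChange,
    add_sub_cancel_left]

/-- **The class of the normalized extension `E_ψ` is `[ψ] ∈ J⁰Hom(A, B)`** (Carlson 1980, proof of
Prop. 2). [cite: Carlson1980, Prop. 2] -/
theorem cls_twistedExtension (hsep : IsSeparated A B) (ψ : ℂ ⊗[ℚ] VA →ₗ[ℂ] ℂ ⊗[ℚ] VB) :
    (twistedExtension A B hsep ψ).cls = JHom.mk A B ψ := by
  rw [Extension.cls_eq_extClass (twistedHodgeSection A B hsep ψ) (twistedRatSection A B hsep ψ),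
    Extension.extClass, reprHom_twistedExtension]

/-- **Carlson's Prop. 2, surjectivity**: for separated `A`, `B`, every element of
`J⁰Hom(A, B) = Hom_ℂ/(F⁰Hom_ℂ + Hom_ℚ)` is the class of an extension of `A` by `B` (namely of a
normalized one, on `VA × VB`) (Carlson 1980, Prop. 2: "`Ext(B, A) ≅ J⁰Hom(B, A)`", transitivity
of the action of `Hom_ℂ`). [cite: Carlson1980, Prop. 2] -/
theorem Extension.cls_surjective (hsep : IsSeparated A B) (c : JHom A B) :
    ∃ E : Extension A B (VA × VB), E.cls = c := by
  obtain ⟨ψ, rfl⟩ := JHom.mk_surjective A B c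
  exact ⟨twistedExtension A B hsep ψ, cls_twistedExtension A B hsep ψ⟩

/-! ### The split extension and non-vacuity -/

/-- The **split extension** `A ⊕ B` of a separated pair: the normalized extension with `ψ = 0`,
i.e. `VA × VB` with the direct-sum filtrations `W_k A × W_k B`, `F^p A × F^p B` (Cattani et al.,
Ex. 3.2.23 (2); Carlson 1980, §2(b): "a split extension is congruent to the trivial one given by
the direct sum"). [cite: CattaniElZeinGriffithsLe2014, Ex. 3.2.23 (2)] -/
def Extension.split (hsep : IsSeparated A B) : Extension A B (VA × VB) :=
  twistedExtension A B hsep 0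

/-- The split extension splits (by `inl : A → A ⊕ B`). [folklore] -/
theorem Extension.isSplit_split (hsep : IsSeparated A B) : (Extension.split A B hsep).IsSplit := by
  refine ⟨⟨⟨LinearMap.inl ℚ VA VB, fun k => ?_, fun p => ?_⟩, ?_⟩⟩
  · rintro _ ⟨a, ha, rfl⟩
    change (a, (0 : VB)) ∈ (A.W k).prod (B.W k)
    exact ⟨ha, Submodule.zero_mem _⟩
  · rintro _ ⟨x, hx, rfl⟩
    change (LinearMap.inl ℚ VA VB).baseChange ℂ x ∈ twistF A B 0 p
    rw [mem_twistF_iff, prodEquiv_inl_baseChange]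
    simpa using hx
  · change LinearMap.fst ℚ VA VB ∘ₗ LinearMap.inl ℚ VA VB = LinearMap.id
    exact LinearMap.fst_comp_inl ℚ VA VB

/-- The class of the split extension vanishes. [folklore] -/
theorem Extension.cls_split (hsep : IsSeparated A B) : (Extension.split A B hsep).cls = 0 := by
  rw [Extension.split, cls_twistedExtension, map_zero]

/-- **Non-vacuity**: a Kummer-type two-step mixed Hodge structure, an extension of the Tate
structure `ℚ(0)` (weight `0`) by `ℚ(1)` (weight `-2`) on `ℚ × ℚ`, with an arbitrary period
`ψ ∈ Hom_ℂ(ℚ(0)_ℂ, ℚ(1)_ℂ)` (Carlson 1980, Example after Prop. 2: extensions of `T⟨p⟩` by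
`T⟨q⟩`, `p > q`, form the one-parameter family `J⁰Hom ≅ ℂ^*`; over `ℚ` the parameter space is
`ℂ / ℚ`). -/
example (ψ : ℂ ⊗[ℚ] ℚ →ₗ[ℂ] ℂ ⊗[ℚ] ℚ) :
    Extension (HodgeStructure.tate 0).toMixedHodgeStructure
      (HodgeStructure.tate 1).toMixedHodgeStructure (ℚ × ℚ) :=
  twistedExtension _ _ (isSeparated_toMixedHodgeStructure (by norm_num) _ _) ψ

end Twisted

end MixedHodgeStructure

end Literature.AlgebraicGeometry.Motives

end
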